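import Mathlib
import HarnessLib
import Literature.RepresentationTheory.CompactGroups.WeylIntegralFormula
import Summits.Ventures.LatticeQCDFlow.Exactness.SpectralKernelJacobianWeylFact
import Summits.Ventures.LatticeQCDFlow.Exactness.SpectralCouplingLayerExactnessWeylFact
import Summits.Ventures.LatticeQCDFlow.Exactness.SU3SpectralCouplingLayerUnconditional
import Summits.Ventures.LatticeQCDFlow.Exactness.SUNTorusChamberDecomposition
import Summits.Ventures.LatticeQCDFlow.Exactness.AlcoveGapChartSUN
import Summits.Ventures.LatticeQCDFlow.Exactness.SpectralKernelMeasurableRecipe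
import Summits.Ventures.LatticeQCDFlow.Exactness.SpectralTorusMapMeasurable

/-!
# `hfJ` for every `N` and the `SU(N)` spectral kernel / coupling layer UNCONDITIONALLY: a Weyl-equivariant eigen-phase flow given on the alcove of `SU(n+1)` by a flow with a Jacobian is an exact transport of `Haar_{SΔ(n+1)}`

HONEST FRAMING: exact (Metropolis-corrected) sampling algorithms for lattice gauge theory;
figures of merit are autocorrelation/cost numbers at stated couplings and volumes; no
continuum-physics claim.

Venture `LatticeQCDFlow` (cell pub-lqcd), topic `Exactness`; FANOUT row 10 (`eng-equiv`, engine
`latflow.equiv` `spectral.py` / `flows_jax.spectral_jax`, general `N`; Boyda et al., PRD 103 (2021)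
074504 §III–IV, App. B).  NEW WORK of the cell assembling this row's `SUNTorusChamberDecomposition.lean`
(Haar on `SΔ(n+1)` by Weyl chambers), `TorusWeylSymmetry.lean`, `SU2TorusAlcoveJacobian.lean`
(`hasJacobian_of_presentation_ae`), `SU3SpectralCouplingLayerUnconditional.lean` (`torusMap_permDiag`)
with the tree's theorem `weylIntegralFormula_specialUnitary_holds`.  Nothing is cited as a fact; no
number; no definition.  With this file the `SU(N)` spectral coupling layer is exact for EVERY `N` given
only the cell flow on the alcove IN FREE EIGEN-PHASE COORDINATES (the engine's simplex/box charts
`ζ_N`, `φ_N` for `N ≥ 4` are coordinate changes not typed here).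

## What is typed (`x(θ) = Fin.snoc θ (−Σθ)`; alcove `A = {θ | x(θ) strictly increasing, x(θ)(last) < x(θ)(0) + 2π}`)

* `alcove_sun_eq_chamber_one`, `exists_permDiag_family_sun`, `torusMap_angleChart_sun` (the alcove's
  measurability and the simplex → alcove gap chart are in `AlcoveGapChartSUN.lean`);
* **`hasJacobian_sunTorus_of_alcoveMap`** — `hfJ` FOR EVERY `N`: an alcove flow `G` with
  `HasJacobian (Leb|_A) G JA`, a measurable Weyl-equivariant torus map `fT` with `fT ∘ E = E ∘ G` on `A`
  and a measurable Weyl-invariant `Jf` with `Jf ∘ E = JA` on `A` give `HasJacobian (Haar SΔ(n+1)) fT Jf`;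
* **`hasJacobian_spectralKernel_sun_of_alcoveMap`**, **`hasJacobian_spectralCouplingLayer_sun_of_alcoveMaps`**
  — the `SU(n+1)` spectral kernel and spectral coupling layer whose (permutation-equivariant, MEASURABLE — no continuity)
  eigenvalue maps are given on the alcove by such flows are exact transports of (⊗)Haar — no named
  hypothesis left, every `N`.

NOT here: the cell charts for `N ≥ 4`; the booked-density form for `N ≥ 4`; any number.
-/

noncomputable section

namespace Summit.Ventures.LatticeQCDFlow.Exactness

open MeasureTheory Matrix Set Real
open Literature.LinearAlgebra.Matrix
open Literature.MathematicalPhysics.QuantumFieldTheory (haarProbability)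
open Literature.RepresentationTheory.CompactGroups
open scoped ENNReal

variable {n : ℕ}

/-! ## The alcove in free eigen-phases, every `N` -/

/-- The alcove is the chamber of the identity permutation. -/
theorem alcove_sun_eq_chamber_one :
    {θ : Fin n → ℝ | StrictMono ((Fin.snoc θ (-∑ k, θ k) : Fin (n + 1) → ℝ) ∘ ⇑(1 : Equiv.Perm (Fin (n + 1)))) ∧
      (Fin.snoc θ (-∑ k, θ k) : Fin (n + 1) → ℝ) ((1 : Equiv.Perm (Fin (n + 1))) (Fin.last n)) <
        (Fin.snoc θ (-∑ k, θ k) : Fin (n + 1) → ℝ) ((1 : Equiv.Perm (Fin (n + 1))) 0) + 2 * π} =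
    {θ : Fin n → ℝ | StrictMono (Fin.snoc θ (-∑ k, θ k) : Fin (n + 1) → ℝ) ∧
      (Fin.snoc θ (-∑ k, θ k) : Fin (n + 1) → ℝ) (Fin.last n) < (Fin.snoc θ (-∑ k, θ k) : Fin (n + 1) → ℝ) 0 + 2 * π} := by
  ext θ
  simp only [Set.mem_setOf_eq, Equiv.Perm.coe_one, Function.comp_id, id_eq]

/-- **The family of phase permutations of `SΔ(n+1)` exists**, each continuous. -/
theorem exists_permDiag_family_sun :
    ∃ P : Equiv.Perm (Fin (n + 1)) → specialDiagonalTorus (Fin (n + 1)) → specialDiagonalTorus (Fin (n + 1)),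
      (∀ σ, Continuous (P σ)) ∧ ∀ σ t i,
        (((P σ t : specialDiagonalTorus (Fin (n + 1))) : Matrix.specialUnitaryGroup (Fin (n + 1)) ℂ) :
          Matrix (Fin (n + 1)) (Fin (n + 1)) ℂ) i i =
          ((t : Matrix.specialUnitaryGroup (Fin (n + 1)) ℂ) : Matrix (Fin (n + 1)) (Fin (n + 1)) ℂ) (σ i) (σ i) :=
  ⟨fun σ => Classical.choose (exists_permDiag_specialDiagonalTorus σ),
    fun σ => (Classical.choose_spec (exists_permDiag_specialDiagonalTorus σ)).1,
    fun σ => (Classical.choose_spec (exists_permDiag_specialDiagonalTorus σ)).2⟩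

/-! ## `hfJ` for every `N` -/

section Torus

variable {E : (Fin n → ℝ) → specialDiagonalTorus (Fin (n + 1))}
  (hE : ∀ θ (i : Fin (n + 1)), (((E θ : specialDiagonalTorus (Fin (n + 1))) : Matrix.specialUnitaryGroup (Fin (n + 1)) ℂ) :
    Matrix (Fin (n + 1)) (Fin (n + 1)) ℂ) i i = (Circle.exp ((Fin.snoc θ (-∑ k, θ k) : Fin (n + 1) → ℝ) i) : ℂ))
  {P : Equiv.Perm (Fin (n + 1)) → specialDiagonalTorus (Fin (n + 1)) → specialDiagonalTorus (Fin (n + 1))}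
  (hP : ∀ σ t i, (((P σ t : specialDiagonalTorus (Fin (n + 1))) : Matrix.specialUnitaryGroup (Fin (n + 1)) ℂ) :
    Matrix (Fin (n + 1)) (Fin (n + 1)) ℂ) i i =
      ((t : Matrix.specialUnitaryGroup (Fin (n + 1)) ℂ) : Matrix (Fin (n + 1)) (Fin (n + 1)) ℂ) (σ i) (σ i))

include hE in
/-- **The torus map on the angle chart**: if `f(e^{i x(θ)}) = e^{i x(G θ)}` then `fT (E θ) = E (G θ)`. -/
theorem torusMap_angleChart_sun {f : (Fin (n + 1) → ℂ) → (Fin (n + 1) → ℂ)}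
    {fT : specialDiagonalTorus (Fin (n + 1)) → specialDiagonalTorus (Fin (n + 1))}
    (hfT : ∀ t : specialDiagonalTorus (Fin (n + 1)),
      ((fT t : Matrix.specialUnitaryGroup (Fin (n + 1)) ℂ) : Matrix (Fin (n + 1)) (Fin (n + 1)) ℂ) =
        diagonal (f fun i => ((t : Matrix.specialUnitaryGroup (Fin (n + 1)) ℂ) : Matrix (Fin (n + 1)) (Fin (n + 1)) ℂ) i i))
    {G : (Fin n → ℝ) → (Fin n → ℝ)} {θ : Fin n → ℝ}
    (hfθ : f (fun i => (Circle.exp ((Fin.snoc θ (-∑ k, θ k) : Fin (n + 1) → ℝ) i) : ℂ)) =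
      fun i => (Circle.exp ((Fin.snoc (G θ) (-∑ k, (G θ) k) : Fin (n + 1) → ℝ) i) : ℂ)) :
    fT (E θ) = E (G θ) := by
  refine specialDiagonalTorus_ext fun i => ?_
  have hentries : (fun i => (((E θ : specialDiagonalTorus (Fin (n + 1))) : Matrix.specialUnitaryGroup (Fin (n + 1)) ℂ) :
      Matrix (Fin (n + 1)) (Fin (n + 1)) ℂ) i i) =
      fun i => (Circle.exp ((Fin.snoc θ (-∑ k, θ k) : Fin (n + 1) → ℝ) i) : ℂ) :=
    funext (hE θ)
  rw [hfT, diagonal_apply_eq, hentries, hfθ, hE]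

include hE hP

/-- **`hfJ` for every `N`: the torus Jacobian of a Weyl-equivariant `SU(n+1)` eigen-phase flow given on
the alcove.**  Let `G` have `HasJacobian (Leb|_A) G JA` on the alcove
`A = {θ | x(θ) strictly increasing, x(θ)(last) < x(θ)(0) + 2π}`; let `fT : SΔ(n+1) → SΔ(n+1)` and `Jf` be
measurable with `fT (E θ) = E (G θ)`, `Jf (E θ) = JA θ` on `A`, `fT` commuting with the phase
permutations and `Jf` invariant under them.  Then `HasJacobian (Haar SΔ(n+1)) fT Jf`. -/
theorem hasJacobian_sunTorus_of_alcoveMap {G : (Fin n → ℝ) → (Fin n → ℝ)} {JA : (Fin n → ℝ) → ℝ≥0∞}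
    (hG : HasJacobian ((volume : Measure (Fin n → ℝ)).restrict
      {θ : Fin n → ℝ | StrictMono (Fin.snoc θ (-∑ k, θ k) : Fin (n + 1) → ℝ) ∧
        (Fin.snoc θ (-∑ k, θ k) : Fin (n + 1) → ℝ) (Fin.last n) <
          (Fin.snoc θ (-∑ k, θ k) : Fin (n + 1) → ℝ) 0 + 2 * π}) G JA)
    {fT : specialDiagonalTorus (Fin (n + 1)) → specialDiagonalTorus (Fin (n + 1))} (hfTm : Measurable fT)
    {Jf : specialDiagonalTorus (Fin (n + 1)) → ℝ≥0∞} (hJfm : Measurable Jf)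
    (hcomm : ∀ θ : Fin n → ℝ, StrictMono (Fin.snoc θ (-∑ k, θ k) : Fin (n + 1) → ℝ) →
      (Fin.snoc θ (-∑ k, θ k) : Fin (n + 1) → ℝ) (Fin.last n) < (Fin.snoc θ (-∑ k, θ k) : Fin (n + 1) → ℝ) 0 + 2 * π →
        fT (E θ) = E (G θ))
    (hJA : ∀ θ : Fin n → ℝ, StrictMono (Fin.snoc θ (-∑ k, θ k) : Fin (n + 1) → ℝ) →
      (Fin.snoc θ (-∑ k, θ k) : Fin (n + 1) → ℝ) (Fin.last n) < (Fin.snoc θ (-∑ k, θ k) : Fin (n + 1) → ℝ) 0 + 2 * π →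
        Jf (E θ) = JA θ)
    (hequiv : ∀ σ t, fT (P σ t) = P σ (fT t)) (hJinv : ∀ σ t, Jf (P σ t) = Jf t) :
    HasJacobian (haarProbability (specialDiagonalTorus (Fin (n + 1)))) fT Jf := by
  haveI : SecondCountableTopology (specialDiagonalTorus (Fin (n + 1))) := secondCountableTopology_specialDiagonalTorus
  have hEm : Measurable E := (continuous_measurable_angleChart_sun hE).2
  have hPm : ∀ σ, Measurable (P σ) := fun σ => (permDiag_surjective_continuous (hP σ)).2.measurable
  have hdecomp : haarProbability (specialDiagonalTorus (Fin (n + 1))) =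
      ∑ σ : Equiv.Perm (Fin (n + 1)), Measure.map (P σ) (((ENNReal.ofReal (2 * π)) ^ n)⁻¹ •
        Measure.map E ((volume : Measure (Fin n → ℝ)).restrict
          {θ : Fin n → ℝ | StrictMono (Fin.snoc θ (-∑ k, θ k) : Fin (n + 1) → ℝ) ∧
            (Fin.snoc θ (-∑ k, θ k) : Fin (n + 1) → ℝ) (Fin.last n) <
              (Fin.snoc θ (-∑ k, θ k) : Fin (n + 1) → ℝ) 0 + 2 * π})) := by
    have h := haarProbability_sunTorus_eq_sum_chambers hE hP
      (C := fun τ : Equiv.Perm (Fin (n + 1)) => {θ : Fin n → ℝ |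
        StrictMono ((Fin.snoc θ (-∑ k, θ k) : Fin (n + 1) → ℝ) ∘ τ) ∧
          (Fin.snoc θ (-∑ k, θ k) : Fin (n + 1) → ℝ) (τ (Fin.last n)) <
            (Fin.snoc θ (-∑ k, θ k) : Fin (n + 1) → ℝ) (τ 0) + 2 * π}) (fun _ _ => Iff.rfl)
    rw [alcove_sun_eq_chamber_one] at h
    exact h
  have hae : ∀ {Q : (Fin n → ℝ) → Prop},
      (∀ θ : Fin n → ℝ, StrictMono (Fin.snoc θ (-∑ k, θ k) : Fin (n + 1) → ℝ) →
        (Fin.snoc θ (-∑ k, θ k) : Fin (n + 1) → ℝ) (Fin.last n) < (Fin.snoc θ (-∑ k, θ k) : Fin (n + 1) → ℝ) 0 + 2 * π →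
          Q θ) →
        ∀ᵐ θ ∂(((ENNReal.ofReal (2 * π)) ^ n)⁻¹ • (volume : Measure (Fin n → ℝ)).restrict
          {θ : Fin n → ℝ | StrictMono (Fin.snoc θ (-∑ k, θ k) : Fin (n + 1) → ℝ) ∧
            (Fin.snoc θ (-∑ k, θ k) : Fin (n + 1) → ℝ) (Fin.last n) <
              (Fin.snoc θ (-∑ k, θ k) : Fin (n + 1) → ℝ) 0 + 2 * π}), Q θ :=
    fun h => Measure.ae_smul_measure ((ae_restrict_iff' measurableSet_alcove_sun).mpr
      (Filter.Eventually.of_forall fun θ hθ => h θ hθ.1 hθ.2)) _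
  have hν : HasJacobian (((ENNReal.ofReal (2 * π)) ^ n)⁻¹ • Measure.map E ((volume : Measure (Fin n → ℝ)).restrict
      {θ : Fin n → ℝ | StrictMono (Fin.snoc θ (-∑ k, θ k) : Fin (n + 1) → ℝ) ∧
        (Fin.snoc θ (-∑ k, θ k) : Fin (n + 1) → ℝ) (Fin.last n) <
          (Fin.snoc θ (-∑ k, θ k) : Fin (n + 1) → ℝ) 0 + 2 * π})) fT Jf :=
    hasJacobian_of_presentation_ae hEm (Measure.map_smul _ _ _) (hG.smul_measure _) hfTm hJfm (hae hcomm) (hae hJA)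
  exact hasJacobian_of_symmetric_pieces' hPm hdecomp hfTm hJfm hν hequiv hJinv

/-- **The `SU(n+1)` spectral kernel is an exact transport of Haar, every `N`, UNCONDITIONALLY.**
Eigenvalue map `f` MEASURABLE (no continuity), permutation-equivariant, given on the alcove by
a flow `G` with `HasJacobian (Leb|_A) G JA` (`f(e^{i x(θ)}) = e^{i x(Gθ)}`); kernel `h` following the
spectral recipe of `f`; torus map `fT`; torus density `Jf` (measurable, `= JA` on the alcove through
`E`, invariant under the phase permutations); booked density `J` (measurable) with Boyda's identity.
Then `HasJacobian (Haar SU(n+1)) h J`; Weyl's formula is the tree's theorem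
`weylIntegralFormula_specialUnitary_holds (Fin (n+1))`. -/
theorem hasJacobian_spectralKernel_sun_of_alcoveMap
    {f : (Fin (n + 1) → ℂ) → (Fin (n + 1) → ℂ)} (hfm : Measurable f)
    (hfperm : ∀ (σ : Equiv.Perm (Fin (n + 1))) (d : Fin (n + 1) → ℂ), (∀ i, ‖d i‖ = 1) →
      f (fun i => d (σ i)) = fun i => f d (σ i))
    {G : (Fin n → ℝ) → (Fin n → ℝ)} {JA : (Fin n → ℝ) → ℝ≥0∞}
    (hG : HasJacobian ((volume : Measure (Fin n → ℝ)).restrict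
      {θ : Fin n → ℝ | StrictMono (Fin.snoc θ (-∑ k, θ k) : Fin (n + 1) → ℝ) ∧
        (Fin.snoc θ (-∑ k, θ k) : Fin (n + 1) → ℝ) (Fin.last n) <
          (Fin.snoc θ (-∑ k, θ k) : Fin (n + 1) → ℝ) 0 + 2 * π}) G JA)
    (hfG : ∀ θ : Fin n → ℝ, StrictMono (Fin.snoc θ (-∑ k, θ k) : Fin (n + 1) → ℝ) →
      (Fin.snoc θ (-∑ k, θ k) : Fin (n + 1) → ℝ) (Fin.last n) < (Fin.snoc θ (-∑ k, θ k) : Fin (n + 1) → ℝ) 0 + 2 * π →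
        f (fun i => (Circle.exp ((Fin.snoc θ (-∑ k, θ k) : Fin (n + 1) → ℝ) i) : ℂ)) =
          fun i => (Circle.exp ((Fin.snoc (G θ) (-∑ k, (G θ) k) : Fin (n + 1) → ℝ) i) : ℂ))
    {h : Matrix.specialUnitaryGroup (Fin (n + 1)) ℂ → Matrix.specialUnitaryGroup (Fin (n + 1)) ℂ}
    (hagree : ∀ (Q : Matrix.specialUnitaryGroup (Fin (n + 1)) ℂ) (V : Matrix (Fin (n + 1)) (Fin (n + 1)) ℂ)
      (d : Fin (n + 1) → ℂ), V ∈ Matrix.unitaryGroup (Fin (n + 1)) ℂ →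
        (Q : Matrix (Fin (n + 1)) (Fin (n + 1)) ℂ) = V * diagonal d * star V →
        ((h Q : Matrix.specialUnitaryGroup (Fin (n + 1)) ℂ) : Matrix (Fin (n + 1)) (Fin (n + 1)) ℂ) =
          V * diagonal (f d) * star V)
    {fT : specialDiagonalTorus (Fin (n + 1)) → specialDiagonalTorus (Fin (n + 1))}
    (hfT : ∀ t : specialDiagonalTorus (Fin (n + 1)),
      ((fT t : Matrix.specialUnitaryGroup (Fin (n + 1)) ℂ) : Matrix (Fin (n + 1)) (Fin (n + 1)) ℂ) =
        diagonal (f fun i => ((t : Matrix.specialUnitaryGroup (Fin (n + 1)) ℂ) : Matrix (Fin (n + 1)) (Fin (n + 1)) ℂ) i i))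
    {Jf : specialDiagonalTorus (Fin (n + 1)) → ℝ≥0∞} (hJfm : Measurable Jf)
    (hJA : ∀ θ : Fin n → ℝ, StrictMono (Fin.snoc θ (-∑ k, θ k) : Fin (n + 1) → ℝ) →
      (Fin.snoc θ (-∑ k, θ k) : Fin (n + 1) → ℝ) (Fin.last n) < (Fin.snoc θ (-∑ k, θ k) : Fin (n + 1) → ℝ) 0 + 2 * π →
        Jf (E θ) = JA θ)
    (hJinv : ∀ σ t, Jf (P σ t) = Jf t)
    {J : Matrix.specialUnitaryGroup (Fin (n + 1)) ℂ → ℝ≥0∞} (hJm : Measurable J)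
    (hJ : ∀ (g : Matrix.specialUnitaryGroup (Fin (n + 1)) ℂ) (t : specialDiagonalTorus (Fin (n + 1))),
      J (g * (t : Matrix.specialUnitaryGroup (Fin (n + 1)) ℂ) * g⁻¹) * ENNReal.ofReal
          ((∏ i, ∏ k ∈ Finset.univ.erase i,
            ‖((t : Matrix.specialUnitaryGroup (Fin (n + 1)) ℂ) : Matrix (Fin (n + 1)) (Fin (n + 1)) ℂ) i i -
              ((t : Matrix.specialUnitaryGroup (Fin (n + 1)) ℂ) : Matrix (Fin (n + 1)) (Fin (n + 1)) ℂ) k k‖) /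
                (Fintype.card (Fin (n + 1))).factorial) =
        Jf t * ENNReal.ofReal
          ((∏ i, ∏ k ∈ Finset.univ.erase i,
            ‖((fT t : Matrix.specialUnitaryGroup (Fin (n + 1)) ℂ) : Matrix (Fin (n + 1)) (Fin (n + 1)) ℂ) i i -
              ((fT t : Matrix.specialUnitaryGroup (Fin (n + 1)) ℂ) : Matrix (Fin (n + 1)) (Fin (n + 1)) ℂ) k k‖) /
                (Fintype.card (Fin (n + 1))).factorial)) :
    HasJacobian (haarProbability (Matrix.specialUnitaryGroup (Fin (n + 1)) ℂ)) h J := by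
  have hfTm : Measurable fT := measurable_torusMap_of_measurable hfm hfT
  have hfJ : HasJacobian (haarProbability (specialDiagonalTorus (Fin (n + 1)))) fT Jf :=
    hasJacobian_sunTorus_of_alcoveMap hE hP hG hfTm hJfm
      (fun θ h0 h1 => torusMap_angleChart_sun hE hfT (hfG θ h0 h1)) hJA
      (fun σ t => torusMap_permDiag (hP σ) (hfperm σ) hfT t) hJinv
  exact hasJacobian_spectralKernel_specialUnitaryGroup_of_measurable hfm hagree hfT hfJ hJm hJ

/-- **The `SU(n+1)` spectral coupling layer is an exact transport of product Haar, every `N`,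
UNCONDITIONALLY** — per active link and frozen context, eigenvalue maps given on the alcove by flows
with Jacobians as above; the eigenvalue maps and the densities only jointly MEASURABLE in
(context, link) — nothing is assumed continuous except the staples. -/
theorem hasJacobian_spectralCouplingLayer_sun_of_alcoveMaps {ι : Type*} [Fintype ι]
    (p : ι → Prop) [DecidablePred p]
    (S : {i // p i} → ({i // ¬p i} → Matrix.specialUnitaryGroup (Fin (n + 1)) ℂ) → Matrix.specialUnitaryGroup (Fin (n + 1)) ℂ)
    (hS : ∀ a, Continuous (S a))
    (f : {i // p i} → ({i // ¬p i} → Matrix.specialUnitaryGroup (Fin (n + 1)) ℂ) → (Fin (n + 1) → ℂ) → (Fin (n + 1) → ℂ))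
    (hfm : ∀ a, Measurable fun q : ({i // ¬p i} → Matrix.specialUnitaryGroup (Fin (n + 1)) ℂ) × (Fin (n + 1) → ℂ) => f a q.1 q.2)
    (hfperm : ∀ a y (σ : Equiv.Perm (Fin (n + 1))) (d : Fin (n + 1) → ℂ), (∀ i, ‖d i‖ = 1) →
      f a y (fun i => d (σ i)) = fun i => f a y d (σ i))
    (G : {i // p i} → ({i // ¬p i} → Matrix.specialUnitaryGroup (Fin (n + 1)) ℂ) → (Fin n → ℝ) → (Fin n → ℝ))
    (JA : {i // p i} → ({i // ¬p i} → Matrix.specialUnitaryGroup (Fin (n + 1)) ℂ) → (Fin n → ℝ) → ℝ≥0∞)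
    (hG : ∀ a y, HasJacobian ((volume : Measure (Fin n → ℝ)).restrict
      {θ : Fin n → ℝ | StrictMono (Fin.snoc θ (-∑ k, θ k) : Fin (n + 1) → ℝ) ∧
        (Fin.snoc θ (-∑ k, θ k) : Fin (n + 1) → ℝ) (Fin.last n) <
          (Fin.snoc θ (-∑ k, θ k) : Fin (n + 1) → ℝ) 0 + 2 * π}) (G a y) (JA a y))
    (hfG : ∀ a y (θ : Fin n → ℝ), StrictMono (Fin.snoc θ (-∑ k, θ k) : Fin (n + 1) → ℝ) →
      (Fin.snoc θ (-∑ k, θ k) : Fin (n + 1) → ℝ) (Fin.last n) < (Fin.snoc θ (-∑ k, θ k) : Fin (n + 1) → ℝ) 0 + 2 * π →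
        f a y (fun i => (Circle.exp ((Fin.snoc θ (-∑ k, θ k) : Fin (n + 1) → ℝ) i) : ℂ)) =
          fun i => (Circle.exp ((Fin.snoc (G a y θ) (-∑ k, (G a y θ) k) : Fin (n + 1) → ℝ) i) : ℂ))
    (h : {i // p i} → ({i // ¬p i} → Matrix.specialUnitaryGroup (Fin (n + 1)) ℂ) →
      Matrix.specialUnitaryGroup (Fin (n + 1)) ℂ → Matrix.specialUnitaryGroup (Fin (n + 1)) ℂ)
    (hagree : ∀ a y (Q : Matrix.specialUnitaryGroup (Fin (n + 1)) ℂ) (V : Matrix (Fin (n + 1)) (Fin (n + 1)) ℂ)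
      (d : Fin (n + 1) → ℂ), V ∈ Matrix.unitaryGroup (Fin (n + 1)) ℂ →
        (Q : Matrix (Fin (n + 1)) (Fin (n + 1)) ℂ) = V * diagonal d * star V →
        ((h a y Q : Matrix.specialUnitaryGroup (Fin (n + 1)) ℂ) : Matrix (Fin (n + 1)) (Fin (n + 1)) ℂ) =
          V * diagonal (f a y d) * star V)
    (fT : {i // p i} → ({i // ¬p i} → Matrix.specialUnitaryGroup (Fin (n + 1)) ℂ) →
      specialDiagonalTorus (Fin (n + 1)) → specialDiagonalTorus (Fin (n + 1)))
    (hfT : ∀ a y (t : specialDiagonalTorus (Fin (n + 1))),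
      ((fT a y t : Matrix.specialUnitaryGroup (Fin (n + 1)) ℂ) : Matrix (Fin (n + 1)) (Fin (n + 1)) ℂ) =
        diagonal (f a y fun i => ((t : Matrix.specialUnitaryGroup (Fin (n + 1)) ℂ) : Matrix (Fin (n + 1)) (Fin (n + 1)) ℂ) i i))
    (JfT : {i // p i} → ({i // ¬p i} → Matrix.specialUnitaryGroup (Fin (n + 1)) ℂ) →
      specialDiagonalTorus (Fin (n + 1)) → ℝ≥0∞)
    (hJfTm : ∀ a y, Measurable (JfT a y))
    (hJA : ∀ a y (θ : Fin n → ℝ), StrictMono (Fin.snoc θ (-∑ k, θ k) : Fin (n + 1) → ℝ) →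
      (Fin.snoc θ (-∑ k, θ k) : Fin (n + 1) → ℝ) (Fin.last n) < (Fin.snoc θ (-∑ k, θ k) : Fin (n + 1) → ℝ) 0 + 2 * π →
        JfT a y (E θ) = JA a y θ)
    (hJinv : ∀ a y σ t, JfT a y (P σ t) = JfT a y t)
    (j : {i // p i} → ({i // ¬p i} → Matrix.specialUnitaryGroup (Fin (n + 1)) ℂ) →
      Matrix.specialUnitaryGroup (Fin (n + 1)) ℂ → ℝ)
    (hjm : ∀ a, Measurable
      fun q : ({i // ¬p i} → Matrix.specialUnitaryGroup (Fin (n + 1)) ℂ) × Matrix.specialUnitaryGroup (Fin (n + 1)) ℂ =>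
        j a q.1 q.2)
    (hj0 : ∀ a y u, 0 ≤ j a y u)
    (hJ : ∀ a y (g : Matrix.specialUnitaryGroup (Fin (n + 1)) ℂ) (t : specialDiagonalTorus (Fin (n + 1))),
      ENNReal.ofReal (j a y (g * (t : Matrix.specialUnitaryGroup (Fin (n + 1)) ℂ) * g⁻¹)) * ENNReal.ofReal
          ((∏ i, ∏ k ∈ Finset.univ.erase i,
            ‖((t : Matrix.specialUnitaryGroup (Fin (n + 1)) ℂ) : Matrix (Fin (n + 1)) (Fin (n + 1)) ℂ) i i -
              ((t : Matrix.specialUnitaryGroup (Fin (n + 1)) ℂ) : Matrix (Fin (n + 1)) (Fin (n + 1)) ℂ) k k‖) /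
                (Fintype.card (Fin (n + 1))).factorial) =
        JfT a y t * ENNReal.ofReal
          ((∏ i, ∏ k ∈ Finset.univ.erase i,
            ‖((fT a y t : Matrix.specialUnitaryGroup (Fin (n + 1)) ℂ) : Matrix (Fin (n + 1)) (Fin (n + 1)) ℂ) i i -
              ((fT a y t : Matrix.specialUnitaryGroup (Fin (n + 1)) ℂ) : Matrix (Fin (n + 1)) (Fin (n + 1)) ℂ) k k‖) /
                (Fintype.card (Fin (n + 1))).factorial)) :
    HasJacobian (Measure.pi fun _ : ι => haarProbability (Matrix.specialUnitaryGroup (Fin (n + 1)) ℂ))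
      (Theory2.coupleFun p fun a y u => h a y (u * S a y) * (u * S a y)⁻¹ * u)
      fun U => ENNReal.ofReal (Theory2.coupleJac p (fun a y u => j a y (u * S a y)) U) := by
  haveI : SecondCountableTopology (Matrix (Fin (n + 1)) (Fin (n + 1)) ℂ) :=
    inferInstanceAs (SecondCountableTopology (Fin (n + 1) → Fin (n + 1) → ℂ))
  haveI : SecondCountableTopology (Matrix.specialUnitaryGroup (Fin (n + 1)) ℂ) :=
    Topology.IsEmbedding.subtypeVal.secondCountableTopology
  have hfslice : ∀ a y, Measurable (f a y) := fun a y => (hfm a).comp (measurable_const.prodMk measurable_id)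
  have hfJ : ∀ a y, HasJacobian (haarProbability (specialDiagonalTorus (Fin (n + 1)))) (fT a y) (JfT a y) := by
    intro a y
    exact hasJacobian_sunTorus_of_alcoveMap hE hP (hG a y)
      (measurable_torusMap_of_measurable (hfslice a y) (hfT a y)) (hJfTm a y)
      (fun θ h0 h1 => torusMap_angleChart_sun hE (hfT a y) (hfG a y θ h0 h1)) (hJA a y)
      (fun σ t => torusMap_permDiag (hP σ) (hfperm a y σ) (hfT a y) t) (hJinv a y)
  have hjloop : ∀ a, Measurable fun q : Matrix.specialUnitaryGroup (Fin (n + 1)) ℂ × ({i // ¬p i} → Matrix.specialUnitaryGroup (Fin (n + 1)) ℂ) =>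
      j a q.2 (q.1 * S a q.2) := fun a =>
    (hjm a).comp (measurable_snd.prodMk (measurable_fst.mul ((hS a).measurable.comp measurable_snd)))
  have hjslice : ∀ a y, Measurable fun g : Matrix.specialUnitaryGroup (Fin (n + 1)) ℂ => ENNReal.ofReal (j a y g) := fun a y =>
    ENNReal.measurable_ofReal.comp ((hjm a).comp (measurable_const.prodMk measurable_id))
  exact hasJacobian_kernelCouplingLayer p S h j
    (fun a => measurable_spectralKernelUpdate_of_measurable (hfm a) (hagree a) (hS a).measurable) hjloop
    (fun a y => hasJacobian_spectralKernel_specialUnitaryGroup_of_measurable (hfslice a y) (hagree a y) (hfT a y)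
      (hfJ a y) (hjslice a y) (hJ a y))
    hj0

end Torus

section AngleChartRegular

/-! ### The angle chart by arguments, and regularity on the alcove (appended 2026-08-24, GEN 14)

Two chart facts every `N` used by the booked-density files downstream (`SUNTorusBookedDensity` and its
successors): reading the free eigen-phases as the arguments of the first `n` diagonal entries recovers
the torus point, and on the alcove the chart point has pairwise distinct diagonal entries (it is
REGULAR) — the torus-side content of the engine's canonicalisation `Algorithm 1` for general `N`. -/

variable {E : (Fin n → ℝ) → specialDiagonalTorus (Fin (n + 1))}
  (hE : ∀ θ (i : Fin (n + 1)), (((E θ : specialDiagonalTorus (Fin (n + 1))) : Matrix.specialUnitaryGroup (Fin (n + 1)) ℂ) :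
    Matrix (Fin (n + 1)) (Fin (n + 1)) ℂ) i i = (Circle.exp ((Fin.snoc θ (-∑ k, θ k) : Fin (n + 1) → ℝ) i) : ℂ))

/-- **The chart through the arguments of the free entries recovers the point**: with
`θ_k = arg t_{kk}` (`k < n`), `e^{i x(θ)_i} = t_ii` for every `i` — hence `E θ = t`. -/
theorem angleChart_sun_arg (t : specialDiagonalTorus (Fin (n + 1))) (i : Fin (n + 1)) :
    (Circle.exp ((Fin.snoc (fun k : Fin n => Complex.arg (((t : Matrix.specialUnitaryGroup (Fin (n + 1)) ℂ) :
        Matrix (Fin (n + 1)) (Fin (n + 1)) ℂ) k.castSucc k.castSucc))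
      (-∑ k : Fin n, Complex.arg (((t : Matrix.specialUnitaryGroup (Fin (n + 1)) ℂ) :
        Matrix (Fin (n + 1)) (Fin (n + 1)) ℂ) k.castSucc k.castSucc)) : Fin (n + 1) → ℝ) i) : ℂ) =
      ((t : Matrix.specialUnitaryGroup (Fin (n + 1)) ℂ) : Matrix (Fin (n + 1)) (Fin (n + 1)) ℂ) i i := by
  have hd1 : ∀ i, ‖((t : Matrix.specialUnitaryGroup (Fin (n + 1)) ℂ) : Matrix (Fin (n + 1)) (Fin (n + 1)) ℂ) i i‖ = 1 :=
    norm_specialDiagonalTorus_apply t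
  have hprod : (∏ k : Fin n, ((t : Matrix.specialUnitaryGroup (Fin (n + 1)) ℂ) : Matrix (Fin (n + 1)) (Fin (n + 1)) ℂ)
      k.castSucc k.castSucc) *
      ((t : Matrix.specialUnitaryGroup (Fin (n + 1)) ℂ) : Matrix (Fin (n + 1)) (Fin (n + 1)) ℂ) (Fin.last n) (Fin.last n) = 1 := by
    have h := (norm_eq_one_and_prod_eq_one_of_mem_specialDiagonalTorus (coe_specialDiagonalTorus_eq_diagonal t)).2
    rw [Fin.prod_univ_castSucc] at h
    exact h
  -- the unimodular free entries as points of the circle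
  have hexp : ∀ k : Fin n, (Circle.exp (Complex.arg (((t : Matrix.specialUnitaryGroup (Fin (n + 1)) ℂ) :
      Matrix (Fin (n + 1)) (Fin (n + 1)) ℂ) k.castSucc k.castSucc)) : ℂ) =
      ((t : Matrix.specialUnitaryGroup (Fin (n + 1)) ℂ) : Matrix (Fin (n + 1)) (Fin (n + 1)) ℂ) k.castSucc k.castSucc := by
    intro k
    have h := Circle.exp_arg ⟨((t : Matrix.specialUnitaryGroup (Fin (n + 1)) ℂ) : Matrix (Fin (n + 1)) (Fin (n + 1)) ℂ)
      k.castSucc k.castSucc, mem_sphere_zero_iff_norm.mpr (hd1 _)⟩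
    exact congrArg Subtype.val h
  induction i using Fin.lastCases with
  | last =>
    rw [Fin.snoc_last, Circle.exp_neg, Circle.coe_inv, ← prod_coe_exp_eq_coe_exp_sum]
    rw [eq_inv_of_mul_eq_one_right hprod]
    congr 1
    exact Finset.prod_congr rfl fun k _ => hexp k
  | cast k => rw [Fin.snoc_castSucc, hexp]

include hE in
/-- **On the alcove the chart point is regular.** -/
theorem angleChart_sun_regular {θ : Fin n → ℝ} (hmono : StrictMono (Fin.snoc θ (-∑ k, θ k) : Fin (n + 1) → ℝ))
    (hlast : (Fin.snoc θ (-∑ k, θ k) : Fin (n + 1) → ℝ) (Fin.last n) < (Fin.snoc θ (-∑ k, θ k) : Fin (n + 1) → ℝ) 0 + 2 * π)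
    (i j : Fin (n + 1)) (hij : i ≠ j) :
    (((E θ : specialDiagonalTorus (Fin (n + 1))) : Matrix.specialUnitaryGroup (Fin (n + 1)) ℂ) :
      Matrix (Fin (n + 1)) (Fin (n + 1)) ℂ) i i ≠
      (((E θ : specialDiagonalTorus (Fin (n + 1))) : Matrix.specialUnitaryGroup (Fin (n + 1)) ℂ) :
        Matrix (Fin (n + 1)) (Fin (n + 1)) ℂ) j j := by
  rw [hE, hE]
  intro h
  obtain ⟨m, hm⟩ := Circle.exp_eq_exp.mp (Subtype.ext h)
  have hmono' : StrictMono ((Fin.snoc θ (-∑ k, θ k) : Fin (n + 1) → ℝ) ∘ ⇑(1 : Equiv.Perm (Fin (n + 1)))) := by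
    simpa only [Equiv.Perm.coe_one, Function.comp_id] using hmono
  have hlt := abs_sub_lt_of_sortedChain hmono' (by simpa only [Equiv.Perm.coe_one, id_eq] using hlast) i j
  have hne := injective_of_strictMono_perm hmono'
  rw [hm, add_sub_cancel_left, abs_mul, abs_of_pos (by positivity : (0 : ℝ) < 2 * π)] at hlt
  have hm1 : |(m : ℝ)| < 1 := by
    by_contra hge
    push Not at hge
    have : (1 : ℝ) * (2 * π) ≤ |(m : ℝ)| * (2 * π) := mul_le_mul_of_nonneg_right hge (by positivity)
    linarith
  have hm0 : m = 0 := by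
    have : |m| < 1 := by exact_mod_cast hm1
    exact Int.abs_lt_one_iff.mp this
  rw [hm0, Int.cast_zero, zero_mul, add_zero] at hm
  exact hij (hne hm)

end AngleChartRegular

end Summit.Ventures.LatticeQCDFlow.Exactness
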